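import Summits.FinalStateConjecture.FinalStateConjecture.Theses.ZeroEnergyKerrOrBomb
import Summits.FinalStateConjecture.FinalStateConjecture.Theses.AnalyticityInvadesErgoregion
import Literature.Geometry.Lorentzian.CausalityOpennessProofs
import Literature.Geometry.Lorentzian.ZeroEnergyRayTrappedModFlow
-- scratch check against the one landed Negative lemma of this crux (cdisprove (b), p73548,
-- `Theorems/ZeroEnergyRigidity/Negative/KerrParameterSign.lean`): it concerns the redundant sign of `a` in
-- the Kerr conclusion; no stub below quantifies Kerr parameters, so none is an instance of it.
import Summits.FinalStateConjecture.FinalStateConjecture.Theorems.ZeroEnergyRigidity.Negative.KerrParameterSign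

/-!
# Line `osculating-frontier-induction` — crux `ZeroEnergyKerrOrBomb.ZeroEnergyRigidity`
# (stmt-FinalStateConjecture-10690)

Skeleton of the line (crux-plan, planner-cruxplan-stmt-FinalStateConjecture-10690-osculating-frontier--0,
2026-08-16), from the triaged crux idea `Cruxes/ZeroEnergyRigidity/Ideas/osculating-frontier-induction.md`
(TRIAGE-r1-2: pass, TRIAGE-r1-3: pass) and the panel's sharpenings.  Line card:
`Lines/osculating-frontier-induction.md`.

## THE CRUX, AND WHAT IT SAYS AS TYPED

`ZeroEnergyRigidity`: a smooth stationary AF vacuum black hole (`StationaryAFBlackHole`) with connected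
non-degenerate future event horizon (h3: a GLOBAL horizon Killing field, Disproof (F3)), globally hyperbolic
carrier, `T ≠ 0` on the d.o.c., and "no zero-energy null ray imprisoned in a compact `K ⊆ doc`" (h6) has d.o.c.
isometric to a sub-extremal Kerr exterior.  The standing disprover's `Disproof.lean` (cycles 1–2) shows, kernel-
checked modulo the vendored non-imprisonment fact: h6 is VOID under h4 (`zeroEnergyRigidity_iff_fullRigidityGH`,
(F2)), h5 is redundant ((F8)), so AS TYPED the crux is full smooth stationary vacuum black-hole uniqueness
(`CoreRigidityGH`), and every GEOMETRIC line on this crux — this one included — targets the recommended restate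
C‴ (`ZeroEnergyRigidityModFlow`: non-trapping MODULO THE FLOW, h3 localised to a collar, horizon-completeness as a
hypothesis; (F5), TRIAGE-r1-2/3 preambles).  This skeleton therefore proves the SHARED smooth Hawking step in the
regular telescope of route `AnalyticityInvadesErgoregion` (AIE) — concluding AIE's target `ErgoregionAnalyticity`
(stmt-13893) and AIE's crux `NonTrappingHawkingRigidity` (stmt-13896) BY NAME on the way — and reaches the typed
decl through ONE dock stub (`stub_dockToCrux`), which after the restate is the honest endgame
(Chruściel–Costa–Heusler axisymmetric uniqueness + Kerr chart transfer, the dock card's (T3)) and before it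
additionally carries the telescope conversion that only the typing levers can pay for (see its docstring).

## THE LINE (frontier induction on the Killing-continuation domain; no pre-chosen sweep)

Telescope (= the hypotheses of `ErgoregionAnalyticity`, verbatim): vacuum, `I⁺`-regular, future-presented,
`T ≠ 0` on the d.o.c., a Killing–timelike collar `(U, K)` on the connected horizon, closed-ergoregion belt compact
modulo `T`, no zero-energy null geodesic trapped modulo `T`.

* REACH.  `reach 𝓑 U' K` := the union of all domains `D ⊆ doc` carrying a local `T`-commuting Killing field that
  DESCENDS from the collar field `K|_{U' ∩ doc}` through a finite chain of one-step continuations (agreement on a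
  non-empty open overlap; `Descends`, an inductive predicate).  Continuation is MULTI-VALUED by design: the reach
  is a plain union, so the monodromy/single-valuedness question raised by TRIAGE-r1-2 (c) / r1-3 (ii) does not
  arise during the induction — it is settled once, at the end, by Nomizu on the (then analytic) simply connected
  d.o.c. (stub S5 = AIE's support item `NomizuAcrossAnalyticDoc`).  The HAIR LOCUS is `F := doc ∖ reach`.
* S3 `stub_reachStructure` — there is a sub-collar `U' ⊆ U` for which the reach and the hair are `T`-invariant
  and the hair is compact modulo `T` (pole contact of the `T`-timelike region with the collar; Müller zum Hagen
  analyticity + Nomizu continuation through the `T`-timelike region along chains — no single-valuedness needed;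
  belt compactness).  [size L]
* S1 `stub_exposedFrontier` — THE LEVER, stated NON-CIRCULARLY (TRIAGE-r1-2 (b)): for EVERY closed `T`-invariant
  test set `F ⊆ doc` off the collar, compact modulo `T`, whose complement is known (`doc ∖ F ⊆ reach`), either
  `F = ∅` or some point `q ∈ F` is EXPOSED: a descended domain `D ⊆ doc ∖ F` and a `T`-invariant support function
  `f`, `df(q) ≠ 0`, `{f < f q} ⊆ D` near `q`, strictly `T`-conditionally pseudo-convex at `q` (every zero-energy
  null geodesic tangent to `{f = f q}` at `q` has `(f∘γ)''(0) < 0`, i.e. bends into the known side) — a 2-jet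
  condition on the KNOWN (stationary–axisymmetric, analytic) geometry at `q`; on Kerr it holds for every `F` with
  `f = r` at the point of minimal `r` (`R′ = −2(r−M)(L²+Q) < 0`, kernel-checked in `SketchIdeator2.lean`).
  [size XL; the open core `C⁺`]
* S2 `stub_frontierExtension` — the in-print local step: in a Ricci-flat manifold a `T`-commuting Killing field
  given on the `T`-conditionally pseudo-convex side `{f < f q}` extends, as a `T`-commuting Killing field, to a
  connected open neighbourhood of `q` (Ionescu–Klainerman JAMS 2013 Thm 1.2 across strongly pseudo-convex
  hypersurfaces; Alexakis–Ionescu–Klainerman CMP 2010 §4.3 Lemma 4.3 + §5 for the `T`-conditional Carleman form;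
  AIK Duke 2014 pp. 3–4).  The extension is a one-step continuation, so `q ∈ reach`.  [size L]
* Induction (kernel-checked, `ergoregionAnalyticity_of`): apply S1 to `F := doc ∖ reach` (closed in `doc` since
  the reach is open, `T`-invariant and compact mod `T` by S3); an exposed `q ∈ F` would lie in the reach by S2 —
  contradiction; so `reach = doc`.
* S4 `stub_reachAnalytic` — full reach ⇒ the metric is chartwise real-analytic at every point of the d.o.c.
  (locally two commuting Killing fields in vacuum: Müller zum Hagen where `T` is timelike, Ernst/σ-model
  ellipticity of the 2-Killing reduction where the orbit 2-planes are timelike; Chruściel–Costa's area-function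
  argument for the degenerate set).  [size L–XL]  ⇒ `ErgoregionAnalyticity` (AIE's TARGET) BY NAME.
* S5 `stub_nomizuAcrossAnalyticDoc` = AIE's support item stmt-13899 verbatim (shared staffing) ⇒ with AIE's
  pure-logic glue (re-proved here, `nonTrappingHawkingRigidity_of_analyticity`) `NonTrappingHawkingRigidity`
  (AIE's CRUX stmt-13896 ≡ `BeltLiouville.SmoothHawkingRigidity` stmt-10441) BY NAME.
* S6 `stub_dockToCrux` (`HawkingStepDocksToCrux` = `NonTrappingHawkingRigidity → ZeroEnergyRigidity`) ⇒ the crux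
  BY NAME (`ZeroEnergyRigidity_of`).

## Disproof.lean honoured (cdisprove cycles 1–2, read 2026-08-16T02:10Z)

* (F2)/(F5): the line targets C‴; it USES non-trapping modulo the flow (S1, via `RegularTelescope`) and never the
  void h6; the typed decl is reached only through the dock S6, whose docstring says what it is before/after the
  restate.  `noTrappedGeodesicModFlow_iff`: the non-trapping clause below is AIE's, letter-identical to
  Disproof's `NoTrappedGeodesicModFlow` (`nonTrapping_iff` below is `Iff.rfl`-level bookkeeping).
* (F3)/(F9)/(F11): `K` is used on a COLLAR only (AIE's `(U, K)` with the ORIENTED sign `g(K,K) < 0` on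
  `U ∩ doc` as a hypothesis of the regular telescope) — the line survives the h3-localisation and never uses the
  accidental global `K`; no stub quantifies "the κ of h3".
* (F7)/TRIAGE band-Kerr: no stub asserts `I⁺`-regularity, compact sections, pole structure or completeness of `K`
  from h1–h6 — they are HYPOTHESES of the regular telescope (S1–S4) exactly as AIE types them; the carvings live
  entirely inside S6's pre-restate reading.
* Near-misses `fullRigidity_false_without_H1/H2/H4`: vacuum is used in S2 (Ricci-flat Carleman/extension) and S4
  (Ernst ellipticity) and S1 (vacuum optics of the known side); connectedness of `𝓔⁺` gives ONE collar, one reach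
  (S3); global hyperbolicity/`I⁺`-regularity enters S3 (structure of the d.o.c.) and S5 (Nomizu needs the simply
  connected d.o.c. of `NonTrappingHawkingRigidity`'s telescope).
* Landed Negative lemma `Negative.KerrParameterSign` (imported above): about the sign of `a`; no stub is an
  instance.  Negatives index for FinalStateConjecture: empty.
-/

set_option linter.dupNamespace false
set_option linter.unusedVariables false
set_option linter.unusedSectionVars false

noncomputable section

namespace Summit.FinalStateConjecture.FinalStateConjecture.Cruxes.ZeroEnergyRigidity.OsculatingFrontierInduction

open Summit.FinalStateConjecture.FinalStateConjecture.Theses.ZeroEnergyKerrOrBomb (ZeroEnergyRigidity)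
open Summit.FinalStateConjecture.FinalStateConjecture.Theses.AnalyticityInvadesErgoregion
  (ErgoregionAnalyticity NomizuAcrossAnalyticDoc NonTrappingHawkingRigidity)
open Literature.Geometry.Lorentzian
open scoped Manifold ContDiff Topology
open Set

/-! ## §1 Vocabulary (all over existing declarations; every clause of the telescope is AIE's, verbatim) -/

section Vocabulary

variable (𝓑 : StationaryAFBlackHole.{0}) [𝓑.metric.HasLeviCivita]

/-- Chartwise real-analyticity of the metric at `y`: some chart `ψ` of the maximal `C^∞` atlas around `y` makes
all metric components `p ↦ g(ψ⁻¹ p)(dψ⁻¹ a, dψ⁻¹ b)` real-analytic on `ψ.target` — verbatim the `let An` of the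
route file `AnalyticityInvadesErgoregion` (`ErgoregionAnalyticity`, `NomizuAcrossAnalyticDoc`), so that
`ErgoregionAnalyticity` unfolds to `∀ …, ∀ x ∈ 𝓑.doc, ChartAnalyticAt 𝓑 x` definitionally
(`ergoregionAnalyticity_iff`). [cite: MullerZumHagen1970] -/
def ChartAnalyticAt (y : 𝓑.carrier) : Prop :=
  ∃ ψ ∈ IsManifold.maximalAtlas (𝓡 4) ((⊤ : ℕ∞) : WithTop ℕ∞) 𝓑.carrier, y ∈ ψ.source ∧
    ∀ a b : E4, AnalyticOnNhd ℝ (fun p : E4 ↦ 𝓑.metric.val (ψ.symm p)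
      (mfderiv 𝓘(ℝ, E4) (𝓡 4) ψ.symm p a) (mfderiv 𝓘(ℝ, E4) (𝓡 4) ψ.symm p b)) ψ.target

/-- `L` is a LOCAL `T`-COMMUTING KILLING FIELD on the set `W`: smooth as a section of `TM` on `W`, the Killing
equation `g(∇_v L, w) + g(v, ∇_w L) = 0` at every point of `W`, and `[T, L] = 0` on `W` (`T = 𝓑.killing`).
Verbatim the three clauses AIE's telescope imposes on the collar field (and its conclusion imposes on `K'`).
[cite: ONeill1983, Ch. 9, Def. 9.22] -/
def IsLocalKilling (W : Set 𝓑.carrier) (L : Π x : 𝓑.carrier, TangentSpace (𝓡 4) x) : Prop :=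
  ContMDiffOn (𝓡 4) ((𝓡 4).prod 𝓘(ℝ, E4)) ((⊤ : ℕ∞) : WithTop ℕ∞)
      (fun x ↦ (Bundle.TotalSpace.mk' E4 x (L x) : TangentBundle (𝓡 4) 𝓑.carrier)) W ∧
    (∀ x ∈ W, ∀ v w : TangentSpace (𝓡 4) x,
      𝓑.metric.val x (𝓑.metric.leviCivita L x v) w + 𝓑.metric.val x v (𝓑.metric.leviCivita L x w) = 0) ∧
    ∀ x ∈ W, VectorField.mlieBracket (𝓡 4) 𝓑.killing L x = 0

/-- The KILLING–TIMELIKE COLLAR hypotheses on `(U, K)` — verbatim AIE: `U` open, `U ⊇ 𝓔⁺`, `𝓔⁺` connected,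
`K` a local `T`-commuting Killing field on `U`, non-zero and flow-tangent on `𝓔⁺`, TIMELIKE on `U ∩ doc` (the
ORIENTED sign, Disproof (F9)/(F11): not a reading of h3). [cite: AlexakisIonescuKlainerman2010, Thm. 1.1] -/
def IsKillingTimelikeCollar (U : Set 𝓑.carrier) (K : Π x : 𝓑.carrier, TangentSpace (𝓡 4) x) : Prop :=
  IsOpen U ∧ 𝓑.horizon ⊆ U ∧ IsConnected 𝓑.horizon ∧ IsLocalKilling 𝓑 U K ∧
    (∀ p ∈ 𝓑.horizon, K p ≠ 0) ∧
    (∀ γ : ℝ → 𝓑.carrier, IsMIntegralCurve γ K → γ 0 ∈ 𝓑.horizon → ∀ t, γ t ∈ 𝓑.horizon) ∧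
    ∀ x ∈ U ∩ 𝓑.doc, 𝓑.metric.val x (K x) (K x) < 0

/-- The closed-ergoregion BELT off the collar is compact modulo the stationary flow — verbatim AIE: the points
of the d.o.c. where `T` is not timelike and which lie off `U` are in the `T`-orbit of a compact `S₀ ⊆ doc`.
[cite: ChruscielCosta2008, §4] -/
def BeltCompactModFlow (U : Set 𝓑.carrier) : Prop :=
  ∃ S₀ : Set 𝓑.carrier, IsCompact S₀ ∧ S₀ ⊆ 𝓑.doc ∧ ∀ y ∈ 𝓑.doc,
    0 ≤ 𝓑.metric.val y (𝓑.killing y) (𝓑.killing y) → y ∉ U → y ∈ stationaryOrbit 𝓑.killing S₀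

/-- NO ZERO-ENERGY NULL GEODESIC TRAPPED MODULO THE FLOW — verbatim AIE (= Disproof.lean's C‴ clause
`NoTrappedGeodesicModFlow` = `¬ 𝓑.HasZeroEnergyRayTrappedModFlow` unfolded, `nonTrapping_iff`): no maximal null
geodesic with `g(γ̇, T) = 0` stays inside the `T`-orbit of a compact subset of the d.o.c.  This is the
Alexakis–Ionescu–Klainerman hypothesis taken modulo the stationary flow. [cite: IonescuKlainerman2015, §4] -/
def NoTrappedGeodesicModFlow : Prop :=
  ∀ S : Set 𝓑.carrier, IsCompact S → S ⊆ 𝓑.doc → ∀ (γ : ℝ → 𝓑.carrier) (s : Set ℝ),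
    IsMaximalGeodesicOn 𝓑.metric.toPseudoRiemannianMetric.leviCivita γ s → s.Nonempty →
      (∀ t ∈ s, 𝓑.metric.val (γ t) (velocity (𝓡 4) γ t) (velocity (𝓡 4) γ t) = 0 ∧
        velocity (𝓡 4) γ t ≠ 0 ∧ 𝓑.metric.val (γ t) (velocity (𝓡 4) γ t) (𝓑.killing (γ t)) = 0) →
      ∃ t ∈ s, γ t ∉ stationaryOrbit 𝓑.killing S

/-- The REGULAR TELESCOPE of the line = exactly the hypotheses of AIE's target `ErgoregionAnalyticity`
(stmt-13893; `ergoregionAnalyticity_iff`): vacuum, `I⁺`-regular (Chruściel–Costa Def. 1.1), future-presented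
(`M = I⁺(M_ext)`), `T ≠ 0` on the d.o.c., Killing–timelike collar, belt compact mod `T`, zero-energy non-trapping
mod `T`.  (No simple connectivity: that enters only through S5.)  This is the restated crux's telescope (Disproof
(F5) + TRIAGE-r1-3 bottom line), not the typed one. [cite: ChruscielCosta2008, Def. 1.1] -/
def RegularTelescope (U : Set 𝓑.carrier) (K : Π x : 𝓑.carrier, TangentSpace (𝓡 4) x) : Prop :=
  𝓑.metric.toPseudoRiemannianMetric.IsRicciFlat ∧ 𝓑.IsIPlusRegular ∧
    (∀ p : 𝓑.carrier, p ∈ 𝓑.metric.chronologicalFuture 𝓑.timeOrientation 𝓑.Mext) ∧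
    (∀ p ∈ 𝓑.doc, 𝓑.killing p ≠ 0) ∧
    IsKillingTimelikeCollar 𝓑 U K ∧ BeltCompactModFlow 𝓑 U ∧ NoTrappedGeodesicModFlow 𝓑

/-- **`f` EXPOSES the complement of `D` at `q`** (from the side of `D`).  On an open `N ∋ q`: `f` is smooth and
`T`-invariant (`df(T) = 0`, so `T` is tangent to the level sets), `df(q) ≠ 0`, the strict sub-level side
`{f < f q} ∩ N ∩ doc` lies in `D` (the KNOWN side), and the level hypersurface `{f = f q}` is STRICTLY
`T`-CONDITIONALLY PSEUDO-CONVEX at `q`: every affinely parametrised null geodesic `γ` on a parameter interval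
around `0` with `γ 0 = q`, ZERO `T`-ENERGY `g(γ̇(0), T) = 0` and tangent to the level set (`(f∘γ)'(0) = 0`)
satisfies `(f∘γ)''(0) < 0` — i.e. `D²f(X,X)(q) < 0` for every null `X ⊥ T` with `X(f) = 0` (along a geodesic
`(f∘γ)'' = D²f(γ̇,γ̇)`), which is Ionescu–Klainerman's strong pseudo-convexity of `O = {f < f q}` at `q`
(JAMS 2013, Def. 1.1: "`D²f(X,X)(p) < 0` for any `X ≠ 0` with `X(f)(p) = 0` and `g(X,X) = 0`", `O ∩ U = {f < 0}`)
RESTRICTED to `T`-orthogonal directions = Alexakis–Ionescu–Klainerman's `T`-conditional pseudo-convexity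
(CMP 2010, Lemma 4.3: the quantitative form `X^αX^β(μ g − D²f) ≥ c|X|²` on `{X(f) = 0, g(T,X) = 0}`, equivalent
to this qualitative one by a Finsler-lemma compactness argument on the 2-plane `T^⊥ ∩ ker df`).  Geometric
meaning: zero-energy light grazing the support hypersurface at `q` bends strictly INTO the known side — on Kerr,
`f = r` from the horizon side: `r̈ = R′/(2Σ²) < 0` (Ionescu–Klainerman 2009; `SketchIdeator2.lean`).  If `T(q)`
is null then `X = T(q)` is admissible and the clause reads `⟨dλ, df⟩(q) < 0`, `λ = g(T,T)` (so the ergosurface is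
never exposed from the `T`-timelike side: the idea card's "kissing" computation).
[cite: IonescuKlainerman2012, Def. 1.1 and Thm. 1.2] [cite: AlexakisIonescuKlainerman2009, §4.3 Lemma 4.3] -/
def ExposedAt (D : Set 𝓑.carrier) (q : 𝓑.carrier) (f : 𝓑.carrier → ℝ) : Prop :=
  ∃ N : Set 𝓑.carrier, IsOpen N ∧ q ∈ N ∧
    ContMDiffOn (𝓡 4) 𝓘(ℝ, ℝ) ((⊤ : ℕ∞) : WithTop ℕ∞) f N ∧
    (∀ x ∈ N, mfderiv (𝓡 4) 𝓘(ℝ, ℝ) f x (𝓑.killing x) = 0) ∧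
    mfderiv (𝓡 4) 𝓘(ℝ, ℝ) f q ≠ 0 ∧
    (∀ x ∈ N ∩ 𝓑.doc, f x < f q → x ∈ D) ∧
    ∀ (γ : ℝ → 𝓑.carrier) (ε : ℝ), 0 < ε →
      IsGeodesicOn 𝓑.metric.leviCivita γ (Set.Ioo (-ε) ε) → γ 0 = q →
      𝓑.metric.IsNull (velocity (𝓡 4) γ 0) →
      𝓑.metric.val (γ 0) (velocity (𝓡 4) γ 0) (𝓑.killing (γ 0)) = 0 →
      deriv (fun s ↦ f (γ s)) 0 = 0 →
      deriv (deriv fun s ↦ f (γ s)) 0 < 0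

/-- **`(D, L)` DESCENDS from the collar field `(U', K)`**: the inductive closure of the base pair `(U' ∩ doc, K)`
under ONE-STEP CONTINUATION — `(D', L')` descends if `D'` is a CONNECTED open subset of the d.o.c. carrying a local
`T`-commuting Killing field `L'` that AGREES with an already-descended `(D, L)` on a non-empty open subset of
`D ∩ D'` (by unique continuation of Killing fields on connected sets, `L'` is then THE continuation of `L`; the
connectedness clause is what keeps junk chains — e.g. switching to a multiple of `T` — out in the rotating case).
Multi-valued by design: two descended fields may disagree on an overlap they were not chained through (Killing
monodromy around hair, TRIAGE-r1-2 (c) / r1-3 (ii)); nothing below needs them to agree. [cite: Nomizu1960, §1] -/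
inductive Descends (U' : Set 𝓑.carrier) (K : Π x : 𝓑.carrier, TangentSpace (𝓡 4) x) :
    Set 𝓑.carrier → (Π x : 𝓑.carrier, TangentSpace (𝓡 4) x) → Prop
  | base : Descends U' K (U' ∩ 𝓑.doc) K
  | step {D : Set 𝓑.carrier} {L : Π x : 𝓑.carrier, TangentSpace (𝓡 4) x}
      {D' : Set 𝓑.carrier} {L' : Π x : 𝓑.carrier, TangentSpace (𝓡 4) x} :
      Descends U' K D L → IsOpen D' → IsConnected D' → D' ⊆ 𝓑.doc → IsLocalKilling 𝓑 D' L' →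
      (∃ O : Set 𝓑.carrier, IsOpen O ∧ O.Nonempty ∧ O ⊆ D ∩ D' ∧ ∀ x ∈ O, L' x = L x) →
      Descends U' K D' L'

/-- **The REACH of the collar field**: the union of all descended domains — the (multi-valued) maximal
Killing-continuation domain `U_Z` of the idea card, maximal BY CONSTRUCTION (any one-step continuation of a
descended pair is descended, `Descends.step`).  Its complement in the d.o.c. is the HAIR LOCUS `F`. [folklore] -/
def reach (U' : Set 𝓑.carrier) (K : Π x : 𝓑.carrier, TangentSpace (𝓡 4) x) : Set 𝓑.carrier :=
  {y | ∃ (D : Set 𝓑.carrier) (L : Π x : 𝓑.carrier, TangentSpace (𝓡 4) x), Descends 𝓑 U' K D L ∧ y ∈ D}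

/-- `R` is invariant under the (complete) stationary flow: whole-line integral curves of `T` starting in `R` stay
in `R`. [folklore] -/
def FlowInvariant (R : Set 𝓑.carrier) : Prop :=
  ∀ γ : ℝ → 𝓑.carrier, IsMIntegralCurve γ 𝓑.killing → γ 0 ∈ R → ∀ t, γ t ∈ R

/-- The hair locus `doc ∖ R` is COMPACT MODULO THE FLOW: it lies in the `T`-orbit of a compact subset of the
d.o.c. [folklore] -/
def HairCompactModFlow (R : Set 𝓑.carrier) : Prop :=
  ∃ S : Set 𝓑.carrier, IsCompact S ∧ S ⊆ 𝓑.doc ∧ 𝓑.doc \ R ⊆ stationaryOrbit 𝓑.killing S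

end Vocabulary

/-! ## §2 Read-backs and small facts (sorry-free) -/

section Facts

variable (𝓑 : StationaryAFBlackHole.{0}) [𝓑.metric.HasLeviCivita]

/-- READ-BACK: AIE's target `ErgoregionAnalyticity` (stmt-13893) is literally "regular telescope ⇒ the d.o.c. is
chartwise analytic" in this file's vocabulary (definitional unfolding; the `let An` is `ChartAnalyticAt`). [folklore] -/
theorem ergoregionAnalyticity_iff :
    ErgoregionAnalyticity ↔
      ∀ (𝓑 : StationaryAFBlackHole.{0}) [𝓑.metric.HasLeviCivita]
        (U : Set 𝓑.carrier) (K : Π x : 𝓑.carrier, TangentSpace (𝓡 4) x),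
        RegularTelescope 𝓑 U K → ∀ x ∈ 𝓑.doc, ChartAnalyticAt 𝓑 x := by
  constructor
  · intro h 𝓑 _ U K hT x hx
    obtain ⟨hvac, hreg, hfp, h5, ⟨hU, hHU, hconn, ⟨hsm, hkil, hcomm⟩, hne, htan, htl⟩, hbelt, hnt⟩ := hT
    exact h 𝓑 hvac hreg hfp h5 U K hU hHU hconn hsm hkil hcomm hne htan htl hbelt hnt x hx
  · intro h 𝓑 _ hvac hreg hfp h5 U K hU hHU hconn hsm hkil hcomm hne htan htl hbelt hnt x hx
    exact h 𝓑 U K ⟨hvac, hreg, hfp, h5, ⟨hU, hHU, hconn, ⟨hsm, hkil, hcomm⟩, hne, htan, htl⟩, hbelt, hnt⟩ x hx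

/-- READ-BACK: the non-trapping clause of the telescope is `¬ HasZeroEnergyRayTrappedModFlow` (the Literature
predicate shared by BeltLiouville / AIE / Disproof.lean's C‴), by the tree lemma
`not_hasZeroEnergyRayTrappedModFlow_iff`. [cite: IonescuKlainerman2015, §4] -/
theorem nonTrapping_iff : NoTrappedGeodesicModFlow 𝓑 ↔ ¬ 𝓑.HasZeroEnergyRayTrappedModFlow :=
  (𝓑.not_hasZeroEnergyRayTrappedModFlow_iff).symm

/-- The d.o.c. is open (O'Neill Lemma 14.3, PROVED in the tree for boundaryless carriers:
`isOpen_chronologicalFuture/Past_holds_of_boundaryless`). [cite: ONeillSemiRiemannian1983, Ch. 14, Lemma 14.3] -/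
theorem isOpen_doc : IsOpen 𝓑.doc :=
  𝓑.isOpen_doc
    (LorentzianMetric.isOpen_chronologicalFuture_holds_of_boundaryless (g := 𝓑.metric) (τ := 𝓑.timeOrientation))
    (LorentzianMetric.isOpen_chronologicalPast_holds_of_boundaryless (g := 𝓑.metric) (τ := 𝓑.timeOrientation))

variable {𝓑}

/-- Restriction of a local `T`-commuting Killing field to a subset. [folklore] -/
theorem IsLocalKilling.mono {W W' : Set 𝓑.carrier} {L : Π x : 𝓑.carrier, TangentSpace (𝓡 4) x}
    (h : IsLocalKilling 𝓑 W L) (hW : W' ⊆ W) : IsLocalKilling 𝓑 W' L :=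
  ⟨h.1.mono hW, fun x hx ↦ h.2.1 x (hW hx), fun x hx ↦ h.2.2 x (hW hx)⟩

/-- Descended domains are open subsets of the d.o.c. carrying local `T`-commuting Killing fields. [folklore] -/
theorem Descends.wf {U U' : Set 𝓑.carrier} {K : Π x : 𝓑.carrier, TangentSpace (𝓡 4) x}
    (hK : IsLocalKilling 𝓑 U K) (hU' : IsOpen U') (hU'U : U' ⊆ U)
    {D : Set 𝓑.carrier} {L : Π x : 𝓑.carrier, TangentSpace (𝓡 4) x} (h : Descends 𝓑 U' K D L) :
    IsOpen D ∧ D ⊆ 𝓑.doc ∧ IsLocalKilling 𝓑 D L := by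
  induction h with
  | base => exact ⟨hU'.inter (isOpen_doc 𝓑), inter_subset_right, hK.mono (inter_subset_left.trans hU'U)⟩
  | step _ hD' _ hD'doc hL' _ _ => exact ⟨hD', hD'doc, hL'⟩

/-- The collar part of the d.o.c. is in the reach (base case). [folklore] -/
theorem inter_doc_subset_reach (U' : Set 𝓑.carrier) (K : Π x : 𝓑.carrier, TangentSpace (𝓡 4) x) :
    U' ∩ 𝓑.doc ⊆ reach 𝓑 U' K :=
  fun _ hy ↦ ⟨_, _, Descends.base, hy⟩

/-- The reach lies in the d.o.c. [folklore] -/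
theorem reach_subset_doc {U U' : Set 𝓑.carrier} {K : Π x : 𝓑.carrier, TangentSpace (𝓡 4) x}
    (hK : IsLocalKilling 𝓑 U K) (hU' : IsOpen U') (hU'U : U' ⊆ U) : reach 𝓑 U' K ⊆ 𝓑.doc := by
  rintro y ⟨D, L, hD, hy⟩
  exact (hD.wf hK hU' hU'U).2.1 hy

/-- The reach is open (a union of open descended domains). [folklore] -/
theorem isOpen_reach {U U' : Set 𝓑.carrier} {K : Π x : 𝓑.carrier, TangentSpace (𝓡 4) x}
    (hK : IsLocalKilling 𝓑 U K) (hU' : IsOpen U') (hU'U : U' ⊆ U) : IsOpen (reach 𝓑 U' K) := by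
  rw [isOpen_iff_forall_mem_open]
  rintro y ⟨D, L, hD, hy⟩
  exact ⟨D, fun z hz ↦ ⟨D, L, hD, hz⟩, (hD.wf hK hU' hU'U).1, hy⟩

/-- Hence the hair locus `doc ∖ reach` is closed in the d.o.c. [folklore] -/
theorem closure_hair_inter_doc_subset {U U' : Set 𝓑.carrier} {K : Π x : 𝓑.carrier, TangentSpace (𝓡 4) x}
    (hK : IsLocalKilling 𝓑 U K) (hU' : IsOpen U') (hU'U : U' ⊆ U) :
    closure (𝓑.doc \ reach 𝓑 U' K) ∩ 𝓑.doc ⊆ 𝓑.doc \ reach 𝓑 U' K := by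
  rintro x ⟨hx, hxdoc⟩
  refine ⟨hxdoc, ?_⟩
  have hsub : 𝓑.doc \ reach 𝓑 U' K ⊆ (reach 𝓑 U' K)ᶜ := fun y hy ↦ hy.2
  exact closure_minimal hsub (isOpen_reach hK hU' hU'U).isClosed_compl hx

end Facts

/-- **The dock statement** `NonTrappingHawkingRigidity → ZeroEnergyRigidity`: the shared smooth Hawking step
(AIE crux stmt-13896 ≡ BeltLiouville target stmt-10441) implies this route's crux.  Named (rather than written as
the type of the stub) so that `ZeroEnergyRigidity_of` is the ONLY theorem of this file whose conclusion is the
crux constant (skeleton audit (i)); see `Holds.stub_dockToCrux` for its two readings. [folklore] -/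
def HawkingStepDocksToCrux : Prop :=
  NonTrappingHawkingRigidity → ZeroEnergyRigidity

/-! ## §3 Registered stubs (`sorry` ONLY here; D-0027 §3.3 shape: `Holds.stub_<name>` + by-name handle)

`ledger skeleton check` registers `Holds.stub_<name>` under the name `stub_<name>` with its statement as the
signature; the by-name handles `def stub_<name> : Prop := type_of% Holds.stub_<name>` are what the layer-invariant
audit `#h21_check_skeleton` requires of the hypotheses of `ZeroEnergyRigidity_of`. -/

namespace Holds

/-- **Stub S1 · exposedFrontier — THE LEVER (`C⁺` of the idea card, in the NON-CIRCULAR form demanded by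
TRIAGE-r1-2 (b)); open; size XL; the lead holds this one.**  For a hole of the regular telescope, a sub-collar
`U' ⊆ U` with `T`-invariant reach, and EVERY test set `F ⊆ doc` — closed in the d.o.c., `T`-invariant, off the
collar `U'`, compact modulo `T`, with KNOWN complement (`doc ∖ F ⊆ reach`: around every point outside `F` the
metric carries a local `T`-commuting Killing field descended from `K`, so it is locally stationary–AXISYMMETRIC
vacuum, hence real-analytic in adapted coordinates and Ernst-determined): `F = ∅`, or some `q ∈ F` is EXPOSED —
there are a descended domain `D ⊆ doc ∖ F` and a support function `f` with `ExposedAt 𝓑 D q f` (`T`-invariant,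
`df(q) ≠ 0`, `{f < f q} ⊆ D` near `q`, strictly `T`-conditionally pseudo-convex at `q`).  The induction consumes
only the instance `F = doc ∖ reach` (the actual hair); quantifying over all test sets is what makes the stub a
statement about the KNOWN geometry (refutable on an explicit stationary–axisymmetric vacuum region with a chosen
`F`) rather than a rewording of the Hawking step.
WHY PLAUSIBLY TRUE. Exposedness at `q` is a condition on the 2-jet of the known analytic axisymmetric metric at
`q`, open in `C²`; zero-energy null geodesics of a stationary–axisymmetric region with zero `T`-energy descend to
geodesics of the Riemannian zero-energy optical (Jacobi) metric `J₃` on the closed-ergoregion part of the `T`-orbit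
space (and to the card's `J = (X/ρ²) q` on the meridian quotient for `Φ`-saturated `F`), so "exposed at `q`" =
"`∂F` strictly `J`-convex from outside at `q`" where `T` is spacelike, is VACUOUS in null directions where `T` is
timelike (any smooth outer support function works), and fails identically only along the ergosurface from the
`T`-timelike side (`D²f(T,T) = ½⟨dλ, df⟩`).  Small `J₃`-convex bodies are exposed everywhere; a nowhere-exposed
`F` needs a boundary with `κ_in ≤ 0` in all grazing zero-energy directions, which for disc shadows costs
`∫ K_J ≥ 2πχ` (Gauss–Bonnet on the known annulus between `∂F₂` and the funnel/wall, TRIAGE-r1-2 (a)) — unavailable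
in the negatively curved funnel layer (`K_J → −(κ_H/Ω_H)²`, funnel law and super-horocyclic start verified in exact
arithmetic on Kerr/Kerr–Taub–NUT, TRIAGE-r1-1 `exact_KJ_out.json`), and a boundary that IS a closed `J`-geodesic
(or a compact totally `J₃`-geodesic surface, which carries closed geodesics) is a zero-energy ray trapped mod `T`,
excluded by `NoTrappedGeodesicModFlow`.  KERR: every `F` is exposed at its point of minimal Boyer–Lindquist `r`
with `f = r` (`R′(r) = −2(r−M)(L²+Q) < 0` on `r > M`: `SketchIdeator2.kerr_zeroEnergy_radialPotential_deriv_neg`,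
kernel-checked) — the statement a refuter should first try to break on a NON-Kerr exact ergoregion
(Tomimatsu–Sato δ=2, Kerr–NUT, double-Kerr; idea card falsifier (2)).
WHY IT MIGHT FAIL. A compact-mod-`T`, closed-geodesic-free region with nowhere strictly `J₃`-convex boundary inside
a non-trapping axisymmetric vacuum ergoregion (TRIAGE-r1-2 (b): "exposedness does NOT follow from non-trapping" in
general Riemannian optics — the bet is vacuum rigidity of `J` + the funnel/wall asymptotics); the funnel-side
start (convexity of thin collar boundaries = "super-horocyclic start") is verified on Kerr/KTN only (TRIAGE-r1-3
sharpen (iii)); non-`Φ`-invariant `F` must be handled in the 3-D orbit space (TRIAGE-r1-3 (i)) — the statement is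
already posed there.
[cite: AlexakisIonescuKlainerman2009, §4.3] [cite: arXiv:0711.0040, Main Thm. (Kerr `r`-levels)]
[cite: IonescuKlainerman2015, §4] [cite: Weinstein1990, §2] [cite: ChruscielCosta2008, §§4–5] -/
theorem stub_exposedFrontier :
    ∀ (𝓑 : StationaryAFBlackHole.{0}) [𝓑.metric.HasLeviCivita]
      (U : Set 𝓑.carrier) (K : Π x : 𝓑.carrier, TangentSpace (𝓡 4) x),
      RegularTelescope 𝓑 U K →
      ∀ U' : Set 𝓑.carrier, IsOpen U' → 𝓑.horizon ⊆ U' → U' ⊆ U → FlowInvariant 𝓑 (reach 𝓑 U' K) →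
        ∀ F : Set 𝓑.carrier, F ⊆ 𝓑.doc → 𝓑.doc \ F ⊆ reach 𝓑 U' K → Disjoint F U' →
          FlowInvariant 𝓑 F → closure F ∩ 𝓑.doc ⊆ F →
          (∃ S : Set 𝓑.carrier, IsCompact S ∧ S ⊆ 𝓑.doc ∧ F ⊆ stationaryOrbit 𝓑.killing S) →
            F = ∅ ∨
              ∃ q ∈ F, ∃ (D : Set 𝓑.carrier) (L : Π x : 𝓑.carrier, TangentSpace (𝓡 4) x)
                (f : 𝓑.carrier → ℝ), Descends 𝓑 U' K D L ∧ D ⊆ 𝓑.doc \ F ∧ ExposedAt 𝓑 D q f := by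
  sorry

/-- **Stub S2 · frontierExtension — local extension of a `T`-commuting Killing field across a
`T`-conditionally pseudo-convex hypersurface in a Ricci-flat spacetime; IN PRINT; size L.**  In a vacuum `𝓑`, let
`L` be a local `T`-commuting Killing field on an open `D ⊆ doc` and let `f` expose the complement of `D` at
`q ∈ doc` (`ExposedAt`: the known side `{f < f q} ∩ N ∩ doc ⊆ D`, strict `T`-conditional pseudo-convexity at
`q`).  Then there are a CONNECTED open `W ∋ q` inside the d.o.c. and a local `T`-commuting Killing field `L'` on
`W` agreeing with `L` on a non-empty open subset of `D ∩ W` — a one-step continuation in the sense of `Descends`.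
PROOF IN PRINT: Ionescu–Klainerman, JAMS 26 (2013) = arXiv:1108.3575, Thm. 1.2 (read: "`O` strongly pseudo-convex
at `p ∈ ∂O` … `g` admits a smooth Killing vector-field `Z` in `O`. Then `Z` extends as a Killing vector-field for
`g` to a neighborhood of `p`"; all dimensions, all signatures) gives the STRONGLY pseudo-convex case; the
`T`-CONDITIONAL case (only `T`-orthogonal null directions constrained, the unknowns `W = 𝓛_L R`, `π = 𝓛_L g`, …
being `𝓛_T`-invariant because `[T, L] = 0` and `T` is Killing) is the Carleman step of Alexakis–Ionescu–Klainerman,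
CMP 299 (2010) = arXiv:0904.0982, §4.3 (Lemma 4.3) + §5 (Prop. 5.4, Lemma "extendedCarl2", from IK 2009 Prop. 3.3 +
AIK 2010a Lemma A.3), used verbatim as a general tool in AIK, Duke 163 (2014) = arXiv:1304.0487, pp. 3–4 ("we can
therefore rely, as well, on the extension results proved in [IoKl], [IoKl2], [AlIoKl2]").  `[T, L'] = 0` on `W`:
`[T, L']` is Killing on the connected `W` and vanishes on the open set where `L' = L`.  `W ⊆ doc`: the d.o.c. is
open (`isOpen_doc`).  The size of `W` depends only on smoothness constants of `g, f` near `q` and the quantitative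
convexity (IK 2013, remark after Thm. 1.2) — not needed here.
WHY IT MIGHT FAIL. Only by transcription: the qualitative `ExposedAt` must be upgraded to AIK's quantitative
`μ g − D²f ≥ c` on `{X f = 0, g(T,X) = 0}` (Finsler's lemma on the 2-plane `T^⊥ ∩ ker df`; the degenerate case
`T(q)` null has `T ∈ T^⊥ ∩ ker df` and is covered by the clause itself), and AIK's wave–transport system must be
set up without their global Kerr-closeness bootstrap (it is local: IK 2013 §2 does exactly this for the strong
case).  On Kerr the statement is the continuation half of Ionescu–Klainerman 2009.
[cite: IonescuKlainerman2012, Thm. 1.2 and Def. 1.1] [cite: AlexakisIonescuKlainerman2009, Lemma 4.3 and Prop. 5.4]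
[cite: arXiv:1304.0487, pp. 3–4] [cite: arXiv:0711.0040, Prop. 3.3] -/
theorem stub_frontierExtension :
    ∀ (𝓑 : StationaryAFBlackHole.{0}) [𝓑.metric.HasLeviCivita],
      𝓑.metric.toPseudoRiemannianMetric.IsRicciFlat →
      ∀ (D : Set 𝓑.carrier) (L : Π x : 𝓑.carrier, TangentSpace (𝓡 4) x),
        IsOpen D → D ⊆ 𝓑.doc → IsLocalKilling 𝓑 D L →
        ∀ q ∈ 𝓑.doc, ∀ f : 𝓑.carrier → ℝ, ExposedAt 𝓑 D q f →
          ∃ (W : Set 𝓑.carrier) (L' : Π x : 𝓑.carrier, TangentSpace (𝓡 4) x),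
            IsOpen W ∧ IsConnected W ∧ q ∈ W ∧ W ⊆ 𝓑.doc ∧ IsLocalKilling 𝓑 W L' ∧
              ∃ O : Set 𝓑.carrier, IsOpen O ∧ O.Nonempty ∧ O ⊆ D ∩ W ∧ ∀ x ∈ O, L' x = L x := by
  sorry

/-- **Stub S3 · reachStructure — where the hair can be; size L.**  For a hole of the regular telescope there is a
sub-collar `U'` (open, `𝓔⁺ ⊆ U' ⊆ U`) such that (i) the reach of `K|_{U'}` is `T`-invariant, (ii) the hair locus
`doc ∖ reach` is `T`-invariant, and (iii) the hair is compact modulo `T` (`HairCompactModFlow`).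
PROOF INTENDED. (i) the stationary flow `φ_t` is by global isometries (`KillingFlowIsometry.lean`) preserving `doc`,
`𝓔⁺` and — for small `t` on the overlap, by `[T, K] = 0` — the collar field, so `(φ_t(D), φ_{t*}L)` descends
whenever `(D, L)` does (chain in small time steps through the open overlaps `φ_s(D) ∩ φ_{s'}(D)`); choose `U'` with
`U' ∩ doc` connected (a component-of-`U` collar of the connected horizon).  (ii) from (i) and `T`-invariance of
`doc = I⁺(M_ext) ∩ I⁻(M_ext)`.  (iii) the reach contains `U' ∩ doc` (base) and the MAIN `T`-TIMELIKE REGION `A₀`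
(the component of `{g(T,T) < 0} ∩ doc` containing `M_ext`): POLE CONTACT — on the collar `K` is timelike and the
axis of `Z̃ = (K − T)/Ω_H` (fixed points of the circle action on the spherical horizon sections; if `K ∥ T` on the
collar the hole is non-rotating and `(doc, cT)` descends in one step) leaves the horizon into `U' ∩ doc`, where
`T = K` is timelike, so `A₀ ∩ U' ∩ doc ≠ ∅`; in `A₀` the metric is real-analytic in harmonic coordinates adapted to
the timelike Killing field (Müller zum Hagen 1970) and Killing germs continue along every path (Nomizu 1960), i.e.
along chains of balls — MULTI-VALUED continuation suffices, no simple connectivity of `A₀` is needed; the rest of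
the d.o.c. off `U` with `T` non-timelike is in the `T`-orbit of the compact `S₀` (`BeltCompactModFlow`), and the
other `T`-timelike components are compact mod `T` by the `I⁺`-regular structure of the d.o.c.
(`doc = ⋃ₜ φₜ(S̄ ∖ ∂S̄)`, `S̄ = K ∪ ends`, Chruściel–Costa 2008 §4; AIK 2014 p. 3: "away from the ergo-region `T`
is time-like and thus `T`-conditional pseudo-convexity is automatically satisfied … Alternatively … real analytic …
[Mu] … [No]").
WHY IT MIGHT FAIL. Pole contact uses spherical horizon sections with a circle action having fixed points (horizon
topology theorem under `I⁺`-regularity; a fixed-point-free action on a toroidal section would detach the collar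
from `A₀`); the `U ∖ U'` bookkeeping of belt compactness when the given `U` has components far from `𝓔⁺`
(choose `U' = U` then, keeping junk collar components in the base — they carry honest local Killing fields).
[cite: MullerZumHagen1970, Thm.] [cite: Nomizu1960, Thm. 1] [cite: ChruscielCosta2008, §4]
[cite: arXiv:1304.0487, p. 3] [cite: ChruscielWald1994Topology, Thm. 2.3] -/
theorem stub_reachStructure :
    ∀ (𝓑 : StationaryAFBlackHole.{0}) [𝓑.metric.HasLeviCivita]
      (U : Set 𝓑.carrier) (K : Π x : 𝓑.carrier, TangentSpace (𝓡 4) x),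
      RegularTelescope 𝓑 U K →
        ∃ U' : Set 𝓑.carrier, IsOpen U' ∧ 𝓑.horizon ⊆ U' ∧ U' ⊆ U ∧
          FlowInvariant 𝓑 (reach 𝓑 U' K) ∧ FlowInvariant 𝓑 (𝓑.doc \ reach 𝓑 U' K) ∧
          HairCompactModFlow 𝓑 (reach 𝓑 U' K) := by
  sorry

/-- **Stub S4 · reachAnalytic — full reach ⇒ chartwise analyticity of the d.o.c.; size L–XL.**  If every point of
the d.o.c. lies in a descended domain, the metric is real-analytic in some chart of the maximal smooth atlas around
every point of the d.o.c. (`ChartAnalyticAt`, AIE's predicate).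
PROOF INTENDED. At `x ∈ doc` pick a descended `(D, L)`, `x ∈ D`: `T` and `L` are commuting Killing fields near `x`
and `g` is Ricci-flat.  (a) `T(x)` timelike: harmonic coordinates adapted to `T` make `g` analytic (Müller zum
Hagen 1970; AIE support `SeedsAtBothEnds`, stmt-13898).  (b) `T(x)` not timelike, orbit 2-plane `span{T, L}`
TIMELIKE at `x` (the generic closed-ergoregion point; in Kerr all of `doc` off the axis): the vacuum equations
reduce on the local orbit space to the elliptic σ-model/Ernst system for the Gram matrix `g(K_a, K_b)` and the
quotient 2-metric (Weyl–Papapetrou/Geroch reduction, ellipticity from the Riemannian quotient; Weinstein 1990 §2,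
Chruściel–Costa 2008 §§5–6), analytic by Morrey's theorem for analytic elliptic systems; lift through the
(analytic) reconstruction.  (c) Degenerate points (orbit plane null or 1-dimensional with `T` non-timelike): shown
ABSENT from the d.o.c. by Chruściel–Costa's area-function argument (`ρ² = −det g(K_a,K_b) > 0` on `doc ∖ axis`,
CC08 Thm. 5.4/5.6; the sign of the Gram determinant is insensitive to the normalisation `L ↦ αT + βL` of the
multi-valued continuation, so `{ρ² > 0}` is well defined on the reach) and `T` timelike on the axis.  Non-rotating
case (`K ∥ T` on the collar, reach = doc in one step): staticity + no ergoregion for static vacuum holes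
(Sudarsky–Wald 1992, Chruściel–Wald 1994 maximal slices; LRR 2012 §3.3.1) puts every point in case (a).
WHY IT MIGHT FAIL. Case (c) is a GLOBAL theorem in CC08 (maximum principle for the harmonic area function between
horizon, axis and infinity, under `I⁺`-regularity) proved there for a global `ℝ × U(1)` action — here the action
is only local/multi-valued until S5; and an axis point of the rotation inside the ergoregion (none in Kerr) would
defeat both (a) and (b). [cite: MullerZumHagen1970, Thm.] [cite: Weinstein1990, §2]
[cite: ChruscielCosta2008, Thm. 5.4, Thm. 5.6 and §6] [cite: Morrey1955, Thm.] [cite: arXiv:1205.6112, §3.3.1] -/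
theorem stub_reachAnalytic :
    ∀ (𝓑 : StationaryAFBlackHole.{0}) [𝓑.metric.HasLeviCivita]
      (U : Set 𝓑.carrier) (K : Π x : 𝓑.carrier, TangentSpace (𝓡 4) x),
      RegularTelescope 𝓑 U K →
      ∀ U' : Set 𝓑.carrier, IsOpen U' → 𝓑.horizon ⊆ U' → U' ⊆ U →
        𝓑.doc ⊆ reach 𝓑 U' K → ∀ x ∈ 𝓑.doc, ChartAnalyticAt 𝓑 x := by
  sorry

/-- **Stub S5 · nomizuAcrossAnalyticDoc** — LITERALLY the support item `NomizuAcrossAnalyticDoc`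
(stmt-FinalStateConjecture-13899, route `AnalyticityInvadesErgoregion`, rank 9, open; SHARED STAFFING: a proof of
that item closes this stub by name).  For an `I⁺`-regular, future-presented `𝓑` with simply connected d.o.c. and a
Killing–timelike collar `(U, K)` on a connected horizon: if the metric is chartwise analytic on the whole d.o.c.,
`K` extends to `K'` smooth and Killing on the d.o.c., commuting with `T`, equal to `K` on `U' ∩ doc` for an open
`U' ⊇ 𝓔⁺` (analytic atlas from the analytic-metric charts; Killing fields of analytic metrics are analytic; Nomizu
1960 on the connected simply connected analytic d.o.c.; `[T, K']` is Killing and vanishes on the collar).  This is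
where single-valuedness (the monodromy of the multi-valued reach) is finally paid for — by simple connectivity of
the d.o.c. of `NonTrappingHawkingRigidity`'s telescope.  Size L (AIE's estimate).
[cite: Nomizu1960, Thm. 1] [cite: ChruscielWald1994Topology, Thm. 2.3] [cite: HawkingEllis1973, Prop. 9.3.6] -/
theorem stub_nomizuAcrossAnalyticDoc : NomizuAcrossAnalyticDoc := by
  sorry

/-- **Stub S6 · dockToCrux — THE DOCK** (`HawkingStepDocksToCrux`, i.e.
`NonTrappingHawkingRigidity → ZeroEnergyRigidity`): the shared smooth Hawking step implies this route's crux.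
TWO READINGS.  (AFTER the pending restate of the crux to C‴ — Disproof (F5), TRIAGE-r1-3 bottom line: telescope :=
AIE's regular telescope + collar non-degeneracy `∇_K K = κK, κ ≠ 0` on `𝓔⁺`, conclusion := the fact-free Kerr
immersion `KerrConclusion` — recommended restate text in the line card.)  The stub is the honest ENDGAME, the dock
card's (T3): the Hawking-step output `K'` (Killing on the d.o.c., `[T, K'] = 0`, `= K` near `𝓔⁺`) makes the hole
stationary–AXISYMMETRIC (`Z̃' = (K' − T)/Ω_H` has closed orbits near the collar, hence everywhere by continuation;
non-rotating case `K' ∥ T`: staticity, Sudarsky–Wald + Chruściel–Wald + Chruściel–Galloway 2010), and the smooth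
axisymmetric uniqueness theorem WITHOUT analyticity (Chruściel–Costa–Heusler, LRR 2012 Thm. 3.2 = tree fact
`ChruscielCostaHeusler2012_axisymmetricUniqueness`, vendored at `IsIPlusRegularNonDegenerate ∧
IsStationaryAxisymmetric`) gives `IsIsometricToKerrExterior`, sub-extremal by collar non-degeneracy (CC08 §6), and
the Kerr chart transfer turns it into the fact-free immersion form (re-introducing the binders `hF hP hres` as the
PROVED tree theorems `isOpen_chronologicalFuture/Past_holds_of_boundaryless` / smooth restriction).  Size L–XL
(adapting the vendored fact, which wants a GLOBAL axisymmetric `Y` with axis, to `K'` given on `doc ∪ U` only).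
(BEFORE the restate, i.e. against the decl AS TYPED.)  The typed hypotheses h1–h6 give MORE than the regular
telescope in one respect (h3's `K` is Killing on the whole carrier, Disproof (F3): then `NonTrappingHawkingRigidity`
is not even needed — two global Killing fields, Beig–Chruściel ⇒ axisymmetry; `K ∥ T` ⇒ static) and LESS in
another (h6 is void (F2); no `I⁺`-regularity / compact horizon sections / future-presentedness, and these do NOT
follow from h4: carved Kerr presentations `I⁻(T·p₀)`, band-Kerr, Disproof (F7), TRIAGE-r1-2/3 — all with TRUE
conclusion), so in that reading the stub is the typing lever of the r1 card `global-horizon-killing-field`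
(TRIAGE-r1-1/2: pass, r1-3: fail as a line) plus a doc-intrinsic endgame for the carvings — NOT a lemma of this
line, not to be staffed before the restate; it is registered so that the skeleton concludes the typed decl by name,
and it is the one stub shared verbatim with the dock line `Lines/dock-hawking-step-shared-crux.*` (if built).
WHY IT MIGHT FAIL (after restate): only through the vendoring gap (global `Y` with non-empty axis vs `K'` on the
d.o.c.; `[T, Y] = 0`; `I⁺`-regularity of the restricted presentation); the mathematics is LRR 2012 Thm. 3.2 +
CC08 §6.  (Before restate): it is as hard as the typed crux minus the regular case — believed true (Disproof (F1)).
[cite: arXiv:1205.6112, Thm. 3.2 and §3.2–3.3] [cite: ChruscielCosta2008, §6 and Thm. 1.3]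
[cite: ChruscielGalloway2010, Thm. 1.1] [cite: arXiv:gr-qc/9610034, Thm. 1.2] [cite: arXiv:1903.09135, Thm. 1.17] -/
theorem stub_dockToCrux : HawkingStepDocksToCrux := by
  sorry

end Holds

/-! ### By-name handles of the six statements (no second copy of the text) -/

/-- Statement of registered stub S1 (`Holds.stub_exposedFrontier`), by name. -/
def stub_exposedFrontier : Prop := type_of% Holds.stub_exposedFrontier

/-- Statement of registered stub S2 (`Holds.stub_frontierExtension`), by name. -/
def stub_frontierExtension : Prop := type_of% Holds.stub_frontierExtension

/-- Statement of registered stub S3 (`Holds.stub_reachStructure`), by name. -/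
def stub_reachStructure : Prop := type_of% Holds.stub_reachStructure

/-- Statement of registered stub S4 (`Holds.stub_reachAnalytic`), by name. -/
def stub_reachAnalytic : Prop := type_of% Holds.stub_reachAnalytic

/-- Statement of registered stub S5 (`Holds.stub_nomizuAcrossAnalyticDoc`), by name (it IS the constant
`NomizuAcrossAnalyticDoc`; the compositions take that route item directly). -/
def stub_nomizuAcrossAnalyticDoc : Prop := type_of% Holds.stub_nomizuAcrossAnalyticDoc

/-- Statement of registered stub S6 (`Holds.stub_dockToCrux`), by name. -/
def stub_dockToCrux : Prop := type_of% Holds.stub_dockToCrux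

/-! ## §4 Compositions (sorry-free, kernel-checked) -/

/-- **THE FRONTIER INDUCTION** — S1 (lever) + S2 (local extension) + S3 (structure of the reach) + S4
(analyticity of the full reach) give AIE's TARGET `ErgoregionAnalyticity` (stmt-FinalStateConjecture-13893) BY
NAME.  The induction has no parameter: apply S1 to the actual hair `F := doc ∖ reach` — closed in the d.o.c.
because the reach is open (`closure_hair_inter_doc_subset`), off the collar because `U' ∩ doc ⊆ reach`
(`inter_doc_subset_reach`), `T`-invariant and compact mod `T` by S3; if `F ≠ ∅`, S1 exposes some `q ∈ F` from a
descended `(D, L)`, S2 continues `L` to a connected open `W ∋ q`, and `Descends.step` puts `q` in the reach —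
contradiction.  So `doc ⊆ reach`, and S4 gives analyticity. [folklore] -/
theorem ergoregionAnalyticity_of (h1 : stub_exposedFrontier) (h2 : stub_frontierExtension)
    (h3 : stub_reachStructure) (h4 : stub_reachAnalytic) : ErgoregionAnalyticity := by
  intro 𝓑 _ hvac hreg hfp h5 U K hU hHU hconn hsm hkil hcomm hne htan htl hbelt hnt x hx
  have hK : IsLocalKilling 𝓑 U K := ⟨hsm, hkil, hcomm⟩
  have hT : RegularTelescope 𝓑 U K :=
    ⟨hvac, hreg, hfp, h5, ⟨hU, hHU, hconn, hK, hne, htan, htl⟩, hbelt, hnt⟩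
  obtain ⟨U', hU'o, hHU', hU'U, hinvR, hinvF, hcpt⟩ := (h3 : type_of% Holds.stub_reachStructure) 𝓑 U K hT
  -- the actual hair
  set F : Set 𝓑.carrier := 𝓑.doc \ reach 𝓑 U' K with hFdef
  have hFdoc : F ⊆ 𝓑.doc := fun y hy ↦ hy.1
  have hknown : 𝓑.doc \ F ⊆ reach 𝓑 U' K := by
    intro y hy
    by_contra hyr
    exact hy.2 ⟨hy.1, hyr⟩
  have hdisj : Disjoint F U' :=
    Set.disjoint_left.2 fun y hyF hyU' ↦ hyF.2 (inter_doc_subset_reach U' K ⟨hyU', hyF.1⟩)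
  have hclosed : closure F ∩ 𝓑.doc ⊆ F := closure_hair_inter_doc_subset hK hU'o hU'U
  have hcptF : ∃ S : Set 𝓑.carrier, IsCompact S ∧ S ⊆ 𝓑.doc ∧ F ⊆ stationaryOrbit 𝓑.killing S := hcpt
  have hreach : 𝓑.doc ⊆ reach 𝓑 U' K := by
    rcases (h1 : type_of% Holds.stub_exposedFrontier) 𝓑 U K hT U' hU'o hHU' hU'U hinvR F hFdoc hknown hdisj
        hinvF hclosed hcptF with hempty | ⟨q, hqF, D, L, f, hD, hDF, hexp⟩
    · intro y hy
      by_contra hyr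
      have : y ∈ F := ⟨hy, hyr⟩
      rw [hempty] at this
      exact this
    · exfalso
      obtain ⟨hDo, hDdoc, hDL⟩ := hD.wf hK hU'o hU'U
      obtain ⟨W, L', hWo, hWc, hqW, hWdoc, hWL, hO⟩ :=
        (h2 : type_of% Holds.stub_frontierExtension) 𝓑 hvac D L hDo hDdoc hDL q (hFdoc hqF) f hexp
      exact hqF.2 ⟨W, L', Descends.step hD hWo hWc hWdoc hWL hO, hqW⟩
  exact (h4 : type_of% Holds.stub_reachAnalytic) 𝓑 U K hT U' hU'o hHU' hU'U hreach x hx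

/-- AIE's pure-logic support `HawkingRigidityOfAnalyticity` (stmt-13901), re-proved here so that the line does
not import AIE's sketch: analyticity of the d.o.c. + the Nomizu step give the smooth Hawking step. [folklore] -/
theorem nonTrappingHawkingRigidity_of_analyticity (hX : ErgoregionAnalyticity)
    (hN : NomizuAcrossAnalyticDoc) : NonTrappingHawkingRigidity := by
  intro 𝓑 _ hvac hreg hfp h5 hsc U K hU hHU hconn hsm hkil hcomm hne htan htl hbelt hnt
  exact hN 𝓑 hreg hfp hsc U K hU hHU hconn hsm hkil hcomm hne htan htl
    (hX 𝓑 hvac hreg hfp h5 U K hU hHU hconn hsm hkil hcomm hne htan htl hbelt hnt)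

/-- **THE SHARED HAWKING STEP** — S1–S4 + S5 (= AIE's item `NomizuAcrossAnalyticDoc`, taken BY NAME as a
registered obligation) give AIE's CRUX `NonTrappingHawkingRigidity` (stmt-FinalStateConjecture-13896; ≡
`BeltLiouville.SmoothHawkingRigidity` stmt-10441 in a laxer telescope) BY NAME. [folklore] -/
theorem nonTrappingHawkingRigidity_of (h1 : stub_exposedFrontier) (h2 : stub_frontierExtension)
    (h3 : stub_reachStructure) (h4 : stub_reachAnalytic) (h5 : NomizuAcrossAnalyticDoc) :
    NonTrappingHawkingRigidity :=
  nonTrappingHawkingRigidity_of_analyticity (ergoregionAnalyticity_of h1 h2 h3 h4) h5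

/-- **`ZeroEnergyRigidity_of` — THE SKELETON**: the registered stubs S1–S4, the shared item S5 and the dock S6
give the crux `ZeroEnergyKerrOrBomb.ZeroEnergyRigidity` BY NAME. [folklore] -/
theorem ZeroEnergyRigidity_of (h1 : stub_exposedFrontier) (h2 : stub_frontierExtension)
    (h3 : stub_reachStructure) (h4 : stub_reachAnalytic) (h5 : NomizuAcrossAnalyticDoc)
    (h6 : stub_dockToCrux) :
    Summit.FinalStateConjecture.FinalStateConjecture.Theses.ZeroEnergyKerrOrBomb.ZeroEnergyRigidity :=
  (show NonTrappingHawkingRigidity → ZeroEnergyRigidity from h6) (nonTrappingHawkingRigidity_of h1 h2 h3 h4 h5)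

/-- D-0027 §3.3: the crux from the registered stubs themselves (an `example`, so that `ZeroEnergyRigidity_of`
stays the unique theorem concluding the crux; it is a proof once the six `sorry`s are discharged). -/
example : Summit.FinalStateConjecture.FinalStateConjecture.Theses.ZeroEnergyKerrOrBomb.ZeroEnergyRigidity :=
  ZeroEnergyRigidity_of Holds.stub_exposedFrontier Holds.stub_frontierExtension Holds.stub_reachStructure
    Holds.stub_reachAnalytic Holds.stub_nomizuAcrossAnalyticDoc Holds.stub_dockToCrux

end Summit.FinalStateConjecture.FinalStateConjecture.Cruxes.ZeroEnergyRigidity.OsculatingFrontierInduction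

end
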